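import Mathlib.Algebra.Ring.Basic
import Mathlib.Data.Nat.Cast.Basic
import Mathlib.Tactic.LinearCombination
import Mathlib.Tactic.Ring
import HarnessLib

/-!
# BirchSwinnertonDyer — rank-2 `Ш[p^∞]` cell, STRUCTURE track: the first Fermat quotient is a logarithm (T15)

HONEST FRAMING (cell `b2b-bsdr2sha`, run/shared/lean/b2b/bsd-rank2-sha/, structure/THEORY-NOTE-C5.md
supplement 15, (15.5) «TYPING TARGET T15»): ELEMENTARY congruences modulo `p²` in an arbitrary commutative
ring — the two lines of commutative algebra behind (15.1)/(15.2) of the note. Nothing here concerns BSD, `Ш`,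
heights, `L`-values or any census number; no definition, no named fact, no axiom. The FORMAL-GROUP input of
(15.1) — «`w_B ≡ (t_B/d_B)·(1 + (a₁/2)·t_B) (mod p²)` with `t_B/d_B = −a_B/b_B` a global unit» — is NOT typed
here: it enters as the hypothesis `w = w₀·(1 + p·s)` (read `w₀ = −a_B/b_B`, `p·s = (a₁/2)·t_B`).

NOTATION. For a unit `u` modulo `p` the first Fermat quotient `FQ₁(u) ∈ R/p` is defined by
`u^{p−1} ≡ 1 + p·FQ₁(u) (mod p²)`; in this file «`FQ₁(u) = q`» is always spelled as the divisibility
`p² ∣ u^{p−1} − (1 + p·q)`, with the exponent kept as a free natural number `n` where the argument allows it.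

WHAT IS TYPED.
* (15.5)(a) `FQ₁` IS ADDITIVE: `uⁿ ≡ 1 + p·q₁`, `vⁿ ≡ 1 + p·q₂ (mod p²)` ⟹ `(u·v)ⁿ ≡ 1 + p·(q₁ + q₂) (mod p²)`
  [`sq_dvd_mul_pow_sub`]; `(1 + p·s)ⁿ ≡ 1 + n·p·s (mod p²)` [`sq_dvd_one_add_mul_pow_sub`], hence at `n = p − 1`
  `(1 + p·s)^{p−1} ≡ 1 − p·s (mod p²)`, i.e. `FQ₁(1 + p·s) ≡ −s (mod p)` [`sq_dvd_one_add_mul_pow_pred_sub`], and the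
  displayed line of (15.5)(a) **`FQ₁(w₀·(1 + p·s)) ≡ FQ₁(w₀) − s (mod p)`** [`fermatQuotient₁_mul_one_add_mul`] — with
  `w₀ = −a_B/b_B`, `p·s = (a₁/2)·t_B` this is the formula `λ(B) = FQ₁(−a_B/b_B) − (a₁/2)·(t_B/p)` of (15.1) (sign MINUS).
* (15.5)(b) THE DETERMINANT STEP: `p ∣ h₁₂ ⟹ h₁₁·h₂₂ − h₁₂² ≡ h₁₁·h₂₂ (mod p²)` [`sq_dvd_det_sub_mul`], and the shape
  used in (15.2): if moreover `h₂₂ = p·η` and `h₁₁ ≡ A (mod p)` then `h₁₁·h₂₂ − h₁₂² ≡ p·A·η (mod p²)`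
  [`sq_dvd_det_sub_of_col_dvd`] — read `A = FQ₂(u)/n′²`, `η = −2·λ(B)/n′²`: `Reg ≡ −2p·FQ₂(u)·λ(B)/n′⁴ (mod p²)`.

All statements are divisibilities `p² ∣ (… − …)` in a commutative ring `R` (Mathlib-only imports; companion of
`Rank2ShaFermatQuotientTaylor` = T14a, which works modulo `p³`). Reference: the cell's THEORY-NOTE-C5.md supplement 15 (LEAD g8, 2026-08-23).
-/

set_option autoImplicit false

-- single-conjunct summit: `Summit.BirchSwinnertonDyer.BirchSwinnertonDyer.…` repeats the name by design
set_option linter.dupNamespace false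

namespace Summit.BirchSwinnertonDyer.BirchSwinnertonDyer.Rank2Sha.Structure.LogFQ

variable {R : Type*} [CommRing R]

/-- **`FQ₁` is additive.** If `uⁿ ≡ 1 + p·q₁ (mod p²)` and `vⁿ ≡ 1 + p·q₂ (mod p²)` then
`(u·v)ⁿ ≡ 1 + p·(q₁ + q₂) (mod p²)`. (At `n = p − 1`: `FQ₁(u·v) ≡ FQ₁(u) + FQ₁(v) (mod p)`.) -/
theorem sq_dvd_mul_pow_sub (p u v q₁ q₂ : R) (n : ℕ) (hu : p ^ 2 ∣ u ^ n - (1 + p * q₁))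
    (hv : p ^ 2 ∣ v ^ n - (1 + p * q₂)) :
    p ^ 2 ∣ (u * v) ^ n - (1 + p * (q₁ + q₂)) := by
  obtain ⟨G, hG⟩ := hu
  obtain ⟨H, hH⟩ := hv
  refine ⟨q₁ * q₂ + G * (1 + p * q₂) + H * (1 + p * q₁) + p ^ 2 * G * H, ?_⟩
  rw [mul_pow]
  linear_combination v ^ n * hG + (1 + p * q₁ + p ^ 2 * G) * hH

/-- `(1 + p·s)ⁿ ≡ 1 + n·p·s (mod p²)` (binomial theorem to first order; induction on `n`). -/
theorem sq_dvd_one_add_mul_pow_sub (p s : R) (n : ℕ) :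
    p ^ 2 ∣ (1 + p * s) ^ n - (1 + n * (p * s)) := by
  induction n with
  | zero => exact ⟨0, by simp⟩
  | succ n ih =>
    obtain ⟨r, hr⟩ := ih
    exact ⟨r * (1 + p * s) + n * s ^ 2, by rw [pow_succ]; push_cast; linear_combination (1 + p * s) * hr⟩

/-- At `n = p − 1` (a natural number `p ≥ 1` cast into `R`): `(1 + p·s)^{p−1} ≡ 1 − p·s (mod p²)`, i.e.
**`FQ₁(1 + p·s) ≡ −s (mod p)`** — because `(p − 1)·p·s = p²·s − p·s`. -/
theorem sq_dvd_one_add_mul_pow_pred_sub (p : ℕ) (hp : 1 ≤ p) (s : R) :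
    (p : R) ^ 2 ∣ (1 + (p : R) * s) ^ (p - 1) - (1 + (p : R) * (-s)) := by
  obtain ⟨c, hc⟩ := sq_dvd_one_add_mul_pow_sub (p : R) s (p - 1)
  have hcast : ((p - 1 : ℕ) : R) = (p : R) - 1 := by
    rw [Nat.cast_sub hp, Nat.cast_one]
  rw [hcast] at hc
  exact ⟨c + s, by linear_combination hc⟩

/-- **(15.5)(a), displayed line.** If `w₀^{p−1} ≡ 1 + p·q (mod p²)` («`FQ₁(w₀) = q`») then
`(w₀·(1 + p·s))^{p−1} ≡ 1 + p·(q − s) (mod p²)`, i.e. **`FQ₁(w₀·(1 + p·s)) ≡ FQ₁(w₀) − s (mod p)`**.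
Reading in (15.1): `w₀ = t_B/d_B = −a_B/b_B` (a global unit), `p·s = (a₁/2)·t_B`, so
`FQ₁(w_B) ≡ FQ₁(−a_B/b_B) − (a₁/2)·(t_B/p) = λ(B)` — with the MINUS sign of the note's erratum. -/
theorem fermatQuotient₁_mul_one_add_mul (p : ℕ) (hp : 1 ≤ p) (w₀ q s : R)
    (hw : (p : R) ^ 2 ∣ w₀ ^ (p - 1) - (1 + (p : R) * q)) :
    (p : R) ^ 2 ∣ (w₀ * (1 + (p : R) * s)) ^ (p - 1) - (1 + (p : R) * (q - s)) := by
  have h := sq_dvd_mul_pow_sub (p : R) w₀ (1 + (p : R) * s) q (-s) (p - 1) hw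
    (sq_dvd_one_add_mul_pow_pred_sub p hp s)
  simpa [sub_eq_add_neg] using h

/-- `FQ₁` of a product of `w₀` with an `n`-th power-type correction, general exponent: if
`w₀ⁿ ≡ 1 + p·q (mod p²)` then `(w₀·(1 + p·s))ⁿ ≡ 1 + p·(q + n·s) (mod p²)`. -/
theorem sq_dvd_mul_one_add_mul_pow_sub (p w₀ q s : R) (n : ℕ)
    (hw : p ^ 2 ∣ w₀ ^ n - (1 + p * q)) :
    p ^ 2 ∣ (w₀ * (1 + p * s)) ^ n - (1 + p * (q + n * s)) := by
  have h1 : p ^ 2 ∣ (1 + p * s) ^ n - (1 + p * (n * s)) := by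
    simpa [mul_comm, mul_left_comm, mul_assoc] using sq_dvd_one_add_mul_pow_sub p s n
  exact sq_dvd_mul_pow_sub p w₀ (1 + p * s) q (n * s) n hw h1

/-- **(15.5)(b), the determinant step.** If `p ∣ h₁₂` then `h₁₁·h₂₂ − h₁₂² ≡ h₁₁·h₂₂ (mod p²)`. -/
theorem sq_dvd_det_sub_mul (p h₁₁ h₁₂ h₂₂ : R) (h12 : p ∣ h₁₂) :
    p ^ 2 ∣ (h₁₁ * h₂₂ - h₁₂ ^ 2) - h₁₁ * h₂₂ := by
  obtain ⟨k, hk⟩ := h12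
  exact ⟨-k ^ 2, by rw [hk]; ring⟩

/-- **(15.2) shape of the determinant step.** If `p ∣ h₁₂`, `h₂₂ = p·η` (valuation `≥ 1` with first digit `η`)
and `h₁₁ ≡ A (mod p)`, then `h₁₁·h₂₂ − h₁₂² ≡ p·A·η (mod p²)`. Reading: `A = FQ₂(u)/n′²` (Theorem A-num),
`η = −2·λ(B)/n′²` ((15.1)), so `Reg = det ≡ −2p·FQ₂(u)·λ(B)/n′⁴ (mod p²)` — the displayed line of (15.2):
`v(Reg) = −1 + [FQ₂(u)·λ(B) ≡ 0]`-type dichotomy once `Reg_p = Reg_H/p²`-normalisations are fixed outside. -/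
theorem sq_dvd_det_sub_of_col_dvd (p h₁₁ h₁₂ h₂₂ η A : R) (h12 : p ∣ h₁₂) (h22 : h₂₂ = p * η)
    (h11 : p ∣ h₁₁ - A) :
    p ^ 2 ∣ (h₁₁ * h₂₂ - h₁₂ ^ 2) - p * A * η := by
  obtain ⟨k, hk⟩ := h12
  obtain ⟨m, hm⟩ := h11
  exact ⟨η * m - k ^ 2, by rw [hk, h22]; linear_combination p * η * hm⟩

/-- **Both digits at once** (the form the census instruments use): under the hypotheses of
`sq_dvd_det_sub_of_col_dvd` with `p ∣ A·η − D`, the determinant is `≡ p·D (mod p²)`; in particular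
(`D = 0`) `p² ∣ det` iff-direction «`FQ₂(u)·λ(B) ≡ 0 ⟹ v(det) ≥ 2`». -/
theorem sq_dvd_det_sub_mul_digit (p h₁₁ h₁₂ h₂₂ η A D : R) (h12 : p ∣ h₁₂) (h22 : h₂₂ = p * η)
    (h11 : p ∣ h₁₁ - A) (hD : p ∣ A * η - D) :
    p ^ 2 ∣ (h₁₁ * h₂₂ - h₁₂ ^ 2) - p * D := by
  obtain ⟨c, hc⟩ := sq_dvd_det_sub_of_col_dvd p h₁₁ h₁₂ h₂₂ η A h12 h22 h11
  obtain ⟨e, he⟩ := hD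
  exact ⟨c + e, by linear_combination hc + p * he⟩

end Summit.BirchSwinnertonDyer.BirchSwinnertonDyer.Rank2Sha.Structure.LogFQ
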